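import Summits.QuantumFields.YangMills.Theorems.BalabanLadderNTCanonicalKernelThree
import HarnessLib

/-!
# Crux `NT` (stmt-QuantumFields-19353), stub `stub_refpkgT : RefPkgT`: CANONICAL ENVELOPES VI — the whole registered clause-5
# margin converges to the intrinsic number `M₃ᶜᵃⁿ(f, g, h)`

Helper file (`--supports stmt-QuantumFields-19353`) of the fleet lead prover of crux `NT` (unit `ym-spine-19353-p1`, GEN 12);
sequel of `…NTCanonicalRiemannThree` / `…NTCanonicalKernelThree`.  Hypothesis-free; real analysis on the witness side.

With `I(F,H) = ∫_{(ℝ⁴)²}|F(p₀)||H(p₁)|/‖p₁−p₀‖⁴`, `J(f,g,h) = ∫_{(ℝ⁴)³}|f(p₀)||g(p₁)||h(p₂)|/min(‖p₁−p₀‖,‖p₂−p₁‖,‖p₂−p₀‖)⁸` and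
`‖w‖₁ = ∫|w|`:

* `tripleSum_split`, `tripleSum_factor₁/₂/₃`, `tripleSum_const` — bookkeeping: the registered per-triple margin summed against
  `|f(a x)||g(a y)||h(a z)|` splits into the three pair terms (each times the free witness's envelope), the `k³` term and the E3 term;
* **`margin₃_tendsto_canonical`** — along any unit map `a > 0`, `a → 0` and reference tori covering the supports, for pairwise
  `δ'`-separated witnesses in the ball of radius `σ`, the registered clause-5 margin converges to
  **`M₃ᶜᵃⁿ = 2·(C₁C₂/κ⁸)·(‖f‖₁ I(g,h) + ‖g‖₁ I(f,h) + ‖h‖₁ I(f,g)) + 2C₁³‖f‖₁‖g‖₁‖h‖₁/κ¹² + (C₃/κ⁴)·J(f,g,h)`**.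

HONEST FRAMING.  Limits of lattice sums; nothing about floors, ceilings, AF, NT, the seam or the gap; not Clay.  Refs: GlimmJaffe1987 §6.1.
-/

set_option autoImplicit false

noncomputable section

open scoped SchwartzMap
open MeasureTheory Filter Topology
open Literature.MathematicalPhysics.QuantumFieldTheory Literature.MathematicalPhysics.QuantumLattice
open Literature.Probability.LatticeModels

namespace Summit.QuantumFields.YangMills.Cruxes.NT.CeilingPrice

/-! ## §1 Bookkeeping of triple sums -/

section Sums

variable {ι : Type*} (S : Finset ι) (F G' H : ι → ℝ)

/-- Linearity of the registered per-triple margin against the product weight. [folklore] -/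
theorem tripleSum_split (p₁ p₂ p₃ p₄ p₅ : ι → ι → ι → ℝ) :
    ∑ x ∈ S, ∑ y ∈ S, ∑ z ∈ S, F x * G' y * H z * (2 * (p₁ x y z + p₂ x y z + p₃ x y z + p₄ x y z) + p₅ x y z) =
      2 * ((∑ x ∈ S, ∑ y ∈ S, ∑ z ∈ S, F x * G' y * H z * p₁ x y z) +
            (∑ x ∈ S, ∑ y ∈ S, ∑ z ∈ S, F x * G' y * H z * p₂ x y z) +
            (∑ x ∈ S, ∑ y ∈ S, ∑ z ∈ S, F x * G' y * H z * p₃ x y z) +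
            (∑ x ∈ S, ∑ y ∈ S, ∑ z ∈ S, F x * G' y * H z * p₄ x y z)) +
        ∑ x ∈ S, ∑ y ∈ S, ∑ z ∈ S, F x * G' y * H z * p₅ x y z := by
  have e : ∀ x y z, F x * G' y * H z * (2 * (p₁ x y z + p₂ x y z + p₃ x y z + p₄ x y z) + p₅ x y z) =
      2 * (F x * G' y * H z * p₁ x y z) + 2 * (F x * G' y * H z * p₂ x y z) + 2 * (F x * G' y * H z * p₃ x y z) +
        2 * (F x * G' y * H z * p₄ x y z) + F x * G' y * H z * p₅ x y z := fun x y z => by ring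
  simp only [e, Finset.sum_add_distrib, ← Finset.mul_sum]
  ring

/-- A kernel in `(y, z)` only: the `x`-sum factors out. [folklore] -/
theorem tripleSum_factor₁ (u : ι → ι → ℝ) :
    ∑ x ∈ S, ∑ y ∈ S, ∑ z ∈ S, F x * G' y * H z * u y z = (∑ x ∈ S, F x) * ∑ y ∈ S, ∑ z ∈ S, G' y * H z * u y z := by
  rw [Finset.sum_mul]
  refine Finset.sum_congr rfl fun x _ => ?_
  rw [Finset.mul_sum]
  refine Finset.sum_congr rfl fun y _ => ?_
  rw [Finset.mul_sum]
  refine Finset.sum_congr rfl fun z _ => ?_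
  ring

/-- A kernel in `(x, z)` only: the `y`-sum factors out. [folklore] -/
theorem tripleSum_factor₂ (u : ι → ι → ℝ) :
    ∑ x ∈ S, ∑ y ∈ S, ∑ z ∈ S, F x * G' y * H z * u x z = (∑ y ∈ S, G' y) * ∑ x ∈ S, ∑ z ∈ S, F x * H z * u x z := by
  rw [Finset.mul_sum]
  refine Finset.sum_congr rfl fun x _ => ?_
  have e : ∀ y, ∑ z ∈ S, F x * G' y * H z * u x z = G' y * ∑ z ∈ S, F x * H z * u x z := fun y => by
    rw [Finset.mul_sum]
    refine Finset.sum_congr rfl fun z _ => ?_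
    ring
  simp_rw [e]
  rw [← Finset.sum_mul]

/-- A kernel in `(x, y)` only: the `z`-sum factors out. [folklore] -/
theorem tripleSum_factor₃ (u : ι → ι → ℝ) :
    ∑ x ∈ S, ∑ y ∈ S, ∑ z ∈ S, F x * G' y * H z * u x y = (∑ z ∈ S, H z) * ∑ x ∈ S, ∑ y ∈ S, F x * G' y * u x y := by
  rw [Finset.mul_sum]
  refine Finset.sum_congr rfl fun x _ => ?_
  rw [Finset.mul_sum]
  refine Finset.sum_congr rfl fun y _ => ?_
  have e : ∀ z, F x * G' y * H z * u x y = H z * (F x * G' y * u x y) := fun z => by ring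
  simp_rw [e]
  rw [← Finset.sum_mul]

/-- A constant kernel: the product of the three sums. [folklore] -/
theorem tripleSum_const (c : ℝ) :
    ∑ x ∈ S, ∑ y ∈ S, ∑ z ∈ S, F x * G' y * H z * c = c * ((∑ x ∈ S, F x) * (∑ y ∈ S, G' y) * (∑ z ∈ S, H z)) := by
  rw [Finset.sum_mul_sum, Finset.sum_mul, Finset.mul_sum]
  refine Finset.sum_congr rfl fun x _ => ?_
  rw [Finset.sum_mul, Finset.mul_sum]
  refine Finset.sum_congr rfl fun y _ => ?_
  rw [Finset.mul_sum, Finset.mul_sum]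
  refine Finset.sum_congr rfl fun z _ => ?_
  ring

end Sums

/-! ## §2 The canonical clause-5 margin -/

section Margin

variable {f g h : 𝓢(EuclideanSpace ℝ (Fin 4), ℝ)} {δ' σ : ℝ}

/-- **The registered clause-5 margin converges to `M₃ᶜᵃⁿ(f, g, h)`.**  For pairwise `δ'`-separated witnesses `f, g, h` (`δ' > 0`)
in the ball of radius `σ ≥ 0`, along any unit map `a > 0`, `a → 0` and boxes covering the supports (`σ ≤ a β·L β` eventually):
the registered per-triple margin summed against `|f(aβ x)||g(aβ y)||h(aβ z)|` tends to
`2·((C₁C₂/κ⁸)(‖f‖₁I(g,h) + ‖g‖₁I(f,h) + ‖h‖₁I(f,g)) + C₁³‖f‖₁‖g‖₁‖h‖₁/κ¹²) + (C₃/κ⁴)J(f,g,h)`. [cite: GlimmJaffe1987, §6.1] -/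
theorem margin₃_tendsto_canonical (hδ' : 0 < δ') (hσ : 0 ≤ σ)
    (hfg : ∀ p q : EuclideanSpace ℝ (Fin 4), f p ≠ 0 → g q ≠ 0 → δ' ≤ ‖p - q‖)
    (hgh : ∀ p q : EuclideanSpace ℝ (Fin 4), g p ≠ 0 → h q ≠ 0 → δ' ≤ ‖p - q‖)
    (hfh : ∀ p q : EuclideanSpace ℝ (Fin 4), f p ≠ 0 → h q ≠ 0 → δ' ≤ ‖p - q‖)
    (hfσ : tsupport (f : EuclideanSpace ℝ (Fin 4) → ℝ) ⊆ Metric.closedBall 0 σ)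
    (hgσ : tsupport (g : EuclideanSpace ℝ (Fin 4) → ℝ) ⊆ Metric.closedBall 0 σ)
    (hhσ : tsupport (h : EuclideanSpace ℝ (Fin 4) → ℝ) ⊆ Metric.closedBall 0 σ) (a : ℝ → ℝ) (L : ℝ → ℕ)
    (ha : ∀ β, 0 < a β) (ha0 : Tendsto a atTop (𝓝 0)) (hL : ∀ᶠ β in atTop, σ ≤ a β * L β) (C₁ C₂ C₃ κ : ℝ) :
    Tendsto (fun β => ∑ x ∈ box 4 (L β), ∑ y ∈ box 4 (L β), ∑ z ∈ box 4 (L β),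
        |f (a β • siteToE x)| * |g (a β • siteToE y)| * |h (a β • siteToE z)| *
          (2 * ((C₁ * (a β / κ) ^ 4) * (C₂ * (a β / κ) ^ 4 / (1 + ‖siteToE (z - y)‖) ^ 4) +
                (C₁ * (a β / κ) ^ 4) * (C₂ * (a β / κ) ^ 4 / (1 + ‖siteToE (z - x)‖) ^ 4) +
                (C₁ * (a β / κ) ^ 4) * (C₂ * (a β / κ) ^ 4 / (1 + ‖siteToE (y - x)‖) ^ 4) +
                (C₁ * (a β / κ) ^ 4) * (C₁ * (a β / κ) ^ 4) * (C₁ * (a β / κ) ^ 4)) +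
            C₃ * (a β / κ) ^ 4 / (1 + min (min ‖siteToE (y - x)‖ ‖siteToE (z - y)‖) ‖siteToE (z - x)‖) ^ 8)) atTop
      (𝓝 (2 * (C₁ * C₂ / κ ^ 8 *
              ((∫ y, |f y|) * ∫ p : Fin 2 → EuclideanSpace ℝ (Fin 4), |g (p 0)| * |h (p 1)| / ‖p 1 - p 0‖ ^ 4) +
            C₁ * C₂ / κ ^ 8 *
              ((∫ y, |g y|) * ∫ p : Fin 2 → EuclideanSpace ℝ (Fin 4), |f (p 0)| * |h (p 1)| / ‖p 1 - p 0‖ ^ 4) +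
            C₁ * C₂ / κ ^ 8 *
              ((∫ y, |h y|) * ∫ p : Fin 2 → EuclideanSpace ℝ (Fin 4), |f (p 0)| * |g (p 1)| / ‖p 1 - p 0‖ ^ 4) +
            C₁ ^ 3 / κ ^ 12 * ((∫ y, |f y|) * (∫ y, |g y|) * (∫ y, |h y|))) +
        C₃ / κ ^ 4 * ∫ p : Fin 3 → EuclideanSpace ℝ (Fin 4), |f (p 0)| * |g (p 1)| * |h (p 2)| /
          min (min ‖p 1 - p 0‖ ‖p 2 - p 1‖) ‖p 2 - p 0‖ ^ 8)) := by
  -- envelopes and kernel terms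
  have hf1 := tendsto_envelope f hfσ a L ha ha0 hL
  have hg1 := tendsto_envelope g hgσ a L ha ha0 hL
  have hh1 := tendsto_envelope h hhσ a L ha ha0 hL
  have hP₁ := pairTerm_tendsto_canonical hδ' hσ hgh hgσ hhσ a L ha ha0 hL
  have hP₂ := pairTerm_tendsto_canonical hδ' hσ hfh hfσ hhσ a L ha ha0 hL
  have hP₃ := pairTerm_tendsto_canonical hδ' hσ hfg hfσ hgσ a L ha ha0 hL
  have hT := tripleTerm_tendsto_canonical hδ' hσ hfg hgh hfh hfσ hgσ hhσ a L ha ha0 hL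
  -- the five limits in the margin's normalisation
  have hQ₁ := ((hf1.mul hP₁).const_mul (C₁ * C₂ / κ ^ 8))
  have hQ₂ := ((hg1.mul hP₂).const_mul (C₁ * C₂ / κ ^ 8))
  have hQ₃ := ((hh1.mul hP₃).const_mul (C₁ * C₂ / κ ^ 8))
  have hQ₄ := (((hf1.mul hg1).mul hh1).const_mul (C₁ ^ 3 / κ ^ 12))
  have hQ₅ := hT.const_mul (C₃ / κ ^ 4)
  have hlim := ((((hQ₁.add hQ₂).add hQ₃).add hQ₄).const_mul 2).add hQ₅
  refine hlim.congr' (Eventually.of_forall fun β => Eq.symm ?_)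
  beta_reduce
  have hs := ha β
  set B := box 4 (L β) with hB
  set t : ℝ := (a β / κ) ^ 4 with ht
  -- split the registered margin and factor each piece
  have hsplit := tripleSum_split B (fun x => |f (a β • siteToE x)|) (fun y => |g (a β • siteToE y)|)
    (fun z => |h (a β • siteToE z)|)
    (fun x y z => (C₁ * t) * (C₂ * t / (1 + ‖siteToE (z - y)‖) ^ 4))
    (fun x y z => (C₁ * t) * (C₂ * t / (1 + ‖siteToE (z - x)‖) ^ 4))
    (fun x y z => (C₁ * t) * (C₂ * t / (1 + ‖siteToE (y - x)‖) ^ 4))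
    (fun x y z => (C₁ * t) * (C₁ * t) * (C₁ * t))
    (fun x y z => C₃ * t / (1 + min (min ‖siteToE (y - x)‖ ‖siteToE (z - y)‖) ‖siteToE (z - x)‖) ^ 8)
  have hF₁ := tripleSum_factor₁ B (fun x => |f (a β • siteToE x)|) (fun y => |g (a β • siteToE y)|)
    (fun z => |h (a β • siteToE z)|) (fun y z => (C₁ * t) * (C₂ * t / (1 + ‖siteToE (z - y)‖) ^ 4))
  have hF₂ := tripleSum_factor₂ B (fun x => |f (a β • siteToE x)|) (fun y => |g (a β • siteToE y)|)
    (fun z => |h (a β • siteToE z)|) (fun x z => (C₁ * t) * (C₂ * t / (1 + ‖siteToE (z - x)‖) ^ 4))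
  have hF₃ := tripleSum_factor₃ B (fun x => |f (a β • siteToE x)|) (fun y => |g (a β • siteToE y)|)
    (fun z => |h (a β • siteToE z)|) (fun x y => (C₁ * t) * (C₂ * t / (1 + ‖siteToE (y - x)‖) ^ 4))
  have hF₄ := tripleSum_const B (fun x => |f (a β • siteToE x)|) (fun y => |g (a β • siteToE y)|)
    (fun z => |h (a β • siteToE z)|) ((C₁ * t) * (C₁ * t) * (C₁ * t))
  beta_reduce at hsplit hF₁ hF₂ hF₃ hF₄
  rw [hsplit, hF₁, hF₂, hF₃, hF₄]
  -- rewrite the pair pieces as `C₁C₂ t² · (pair sum)` and the E3 piece as `C₃ t · (triple sum)`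
  have hp₁ : ∑ y ∈ B, ∑ z ∈ B, |g (a β • siteToE y)| * |h (a β • siteToE z)| *
      ((C₁ * t) * (C₂ * t / (1 + ‖siteToE (z - y)‖) ^ 4)) =
      C₁ * C₂ * t ^ 2 * ∑ y ∈ B, ∑ z ∈ B, |g (a β • siteToE y)| * |h (a β • siteToE z)| / (1 + ‖siteToE (z - y)‖) ^ 4 := by
    rw [Finset.mul_sum]; refine Finset.sum_congr rfl fun y _ => ?_
    rw [Finset.mul_sum]; refine Finset.sum_congr rfl fun z _ => ?_
    ring
  have hp₂ : ∑ x ∈ B, ∑ z ∈ B, |f (a β • siteToE x)| * |h (a β • siteToE z)| *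
      ((C₁ * t) * (C₂ * t / (1 + ‖siteToE (z - x)‖) ^ 4)) =
      C₁ * C₂ * t ^ 2 * ∑ x ∈ B, ∑ z ∈ B, |f (a β • siteToE x)| * |h (a β • siteToE z)| / (1 + ‖siteToE (z - x)‖) ^ 4 := by
    rw [Finset.mul_sum]; refine Finset.sum_congr rfl fun x _ => ?_
    rw [Finset.mul_sum]; refine Finset.sum_congr rfl fun z _ => ?_
    ring
  have hp₃ : ∑ x ∈ B, ∑ y ∈ B, |f (a β • siteToE x)| * |g (a β • siteToE y)| *
      ((C₁ * t) * (C₂ * t / (1 + ‖siteToE (y - x)‖) ^ 4)) =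
      C₁ * C₂ * t ^ 2 * ∑ x ∈ B, ∑ y ∈ B, |f (a β • siteToE x)| * |g (a β • siteToE y)| / (1 + ‖siteToE (y - x)‖) ^ 4 := by
    rw [Finset.mul_sum]; refine Finset.sum_congr rfl fun x _ => ?_
    rw [Finset.mul_sum]; refine Finset.sum_congr rfl fun y _ => ?_
    ring
  have hp₅ : ∑ x ∈ B, ∑ y ∈ B, ∑ z ∈ B, |f (a β • siteToE x)| * |g (a β • siteToE y)| * |h (a β • siteToE z)| *
      (C₃ * t / (1 + min (min ‖siteToE (y - x)‖ ‖siteToE (z - y)‖) ‖siteToE (z - x)‖) ^ 8) =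
      C₃ * t * ∑ x ∈ B, ∑ y ∈ B, ∑ z ∈ B, |f (a β • siteToE x)| * |g (a β • siteToE y)| * |h (a β • siteToE z)| /
        (1 + min (min ‖siteToE (y - x)‖ ‖siteToE (z - y)‖) ‖siteToE (z - x)‖) ^ 8 := by
    rw [Finset.mul_sum]; refine Finset.sum_congr rfl fun x _ => ?_
    rw [Finset.mul_sum]; refine Finset.sum_congr rfl fun y _ => ?_
    rw [Finset.mul_sum]; refine Finset.sum_congr rfl fun z _ => ?_
    ring
  rw [hp₁, hp₂, hp₃, hp₅, ht]
  by_cases hk : κ = 0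
  · subst hk
    simp
  rw [div_pow]
  field_simp

end Margin

end Summit.QuantumFields.YangMills.Cruxes.NT.CeilingPrice

end
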